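/-
Copyright (c) 2026 the pub-hodgecm-mathlib formalisation cell (harness21).  Track B «K2-LIT» prover seat hodgecm-mathlib-K2E3-p21 (g0), 2026-09-03: (S)-WILD, first rung —
the ROOT-STAR HOROCYCLE STEP of the `U(3)` lattice tree at a RAMIFIED QUADRATIC DATUM of ANY residue characteristic (the `|2| < 1` twin of ★ R1
`UnitaryLatticeTreeHorocycleRootStarOfInvolution` (H2-v2), whose trace-one element does not exist at a dyadic place).  Dealer K2E3-plan (g1) DEALS BATCH #1 «p21 … (X0′) core
parametrised by ★ p854998»; feasibility word K2/STATUS 22:06:26Z: the wild EP-NORM-ONE ∕ CROSS-ZERO tower hinges on the horocycle step (S) at the wild datum.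
-/
import Literature.NumberTheory.Automorphic.UnitaryLatticeTreeHorocycleRootStarOfInvolution   -- ★ R1 (F0P2-p01 (g27)): (T-inv), (H2-tr) — this file re-proves (H2) from an isotropic-representative hypothesis and discharges it at the wild datum; brings ★ V2a's letters (`firstColumn_props`, `mem_mapGL_N₁_iff`, `mapGL_N₁_le`, `B₀`, `unipotentU`, `latticeGraphIso`, `upperUnipotent_mulVec`)
import Literature.NumberTheory.Automorphic.UnitaryLatticeTreeRootStarCountWild               -- ★ p854714 (LH4-p02 (g12)): `mem_neighborSet_root_iff_exists_mem_unitaryInt_of_even` and its corollary `exists_isotropic_forall_mem_iff_of_mem_neighborSet_root_of_even` (V2a at a ramified datum: every neighbour of the root is `N_x`, `x` primitive exactly isotropic — no trace element); brings ★ p854659, ★ p854568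
import Literature.NumberTheory.Automorphic.UnitaryThreeFourFrameDefs                          -- ★ p854559 (B-p04): the datum token `IsRamifiedQuadraticDatum σ ϖ d t`
import HarnessLib

/-!
# Horocycle steps of the `U(3)` tree at a RAMIFIED QUADRATIC DATUM (tame or WILD), I: the ROOT STAR as one horocycle step —
# `star(A 0) = {A (−1)} ⊔ (N ∩ Stab(A 0)) · A 1` with NO trace-one element (Bruhat–Tits 1972 §10, (4.4.4); Tits 1979 §2.7, §2.10; Serre, *Trees* II.1.1; Rogawski 1990 §1.10)

THE SETTING.  `K` a valued field with finite residue field, `σ` an isometric involution (`hσ : σσ = 1`, `hvσ : |σ a| = |a|`), `ϖ` ANY uniformiser (`hϖ : |ϖ| = q⁻¹`),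
`J₀ = antidiag(1,1,1)`, `U = U(σ, J₀)` acting on the lattice tree by ★ `latticeGraphIso`; `N` the upper unipotent radical (★ `unipotentU`).  The standard apartment is the
bi-infinite path `A : ℤ → 𝓥` (HYPOTHESIS-STYLE `(A, hA0, hA1)` as in ★ R1): `A (2a) = latt diag(ϖ^a, 1, ϖ^{-a})` (self-dual), `A (2a+1) = latt diag(ϖ^{a+1}, 1, ϖ^{-a})` (type two).
The RAMIFIED letters are those of Track A's datum `IsRamifiedQuadraticDatum σ ϖ d t` (★ `UnitaryThreeFourFrameDefs`): `heven` (a non-zero `σ`-fixed element has EVEN valuation —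
the extension is ramified), `hd : |ϖ − σϖ| = |ϖ|^d`, `1 ≤ d` (the different number), `h2t : |2| = |ϖ|^t` (`t = 0` tame, `t ≥ 1` WILD ∕ dyadic) — NO `σϖ = −ϖ`, NO `|2| = 1`, NO norm
hypothesis.
Cell `pub/hodgecm-mathlib` (D-0151), crux H413 = `stmt-HodgeConjecture-24833`, lane `--supports … --as helper`; Track B «K2-LIT» engine E3 (K2E3-plan (g1) DEALS BATCH #1, seat K2E3-p21:
the (X0′)∕EP-NORM-ONE tower at a wild place), junction Track A LH4 «(D-RAM) FOUR-FRAME» unit U0 (the wild tree; its announced-but-untyped horocycle rows).  Topic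
`NumberTheory/Automorphic`; namespace `Literature.NumberTheory.Automorphic.UnitaryLatticeTree`.  THEOREMS ONLY (no definition, no instance, no notation, no named fact, no `sorry`).

WHY A NEW FILE.  ★ R1's (H2-tr) `exists_mem_unipotentU_apply_apartmentEnum_one_eq_of_adj_zero_of_trace` needs `htrace : ∃ t, |t| ≤ 1 ∧ t + σ t = 1` — at a place with `|2| = 1` it is
`t = 2⁻¹` ((H2-v2)), but at a WILDLY ramified (dyadic) place NO integral element of trace one exists (`Tr 𝒪_E ⊆ 𝔭_F`).  The trace element enters (H2-tr) at ONE point only: ★ V2a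
`exists_isotropic_forall_mem_iff_of_mem_neighborSet_root_of_trace` (every neighbour of the root is a residual hyperplane `N_x`, `x ∈ 𝒪³` primitive and EXACTLY isotropic).  At a ramified
datum the same representative comes for free from Track A's WILD ROOT-STAR TRANSITIVITY ★ p854714∕p854659 `mem_neighborSet_root_iff_exists_mem_unitaryInt_of_even` (`star(𝒪³) =
K₀ · N₁`): `x := κ e₀` is integral, primitive and exactly isotropic (★ `firstColumn_props`) and `κ · N₁ = N_{κ e₀}` (★ `mem_mapGL_N₁_iff`).  ★ p854714 already states
this as `exists_isotropic_forall_mem_iff_of_mem_neighborSet_root_of_even` (V2a at the datum).  So this file (§1) re-issues (H2) with the representative as a HYPOTHESIS `hrep` — ★ R1's proof VERBATIM after its first `obtain` (the Heisenberg element `u(a, b)` with last column `x ∕ x₂`, unitary because `x` is isotropic; no `ϖ`,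
no `2`, no trace) — and (§2) discharges `hrep` at the ramified datum by ★ `…_of_even`.  Conclusions VERBATIM = ★ (H2)'s, so ★ R3 `UnitaryLatticeTreeHorocycleStepsOfInvolution` (S), ★ A-II
`…HorosphereTransversalOfInvolution` (H5)–(H8) and ★ `…OrbitsViaApartmentOfInvolution` token-pass over it at a wild place once the type-two step (H3)-WILD (file II) lands.
HONEST LABEL: count-neutral generic lattice-tree layer; it re-proves the tame ramified case (`t = 0`) and is NEW at dyadic places (`t ≥ 1`); the type-two step (H3) at a wild datum
(★ R2 `…HorocycleTypeTwoStarRamified` uses `σϖ = −ϖ` and `|2| = 1` genuinely) is NOT in this file; h413 OPEN; HC_CM is proved only modulo the 7 printed citations (2 remaining named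
inputs hLiu418 = `stmt-HodgeConjecture-24832`, h413 = `stmt-HodgeConjecture-24833`) until rung 0 closes; nothing printed is asserted here — elementary lattice algebra over a valued field.

THIS FILE.
* §1 **(H2-rep)** `exists_mem_unipotentU_apply_apartmentEnum_one_eq_of_adj_zero_of_isotropicRep` (`hσ hvσ hϖ hrep`): THE ROOT STAR AS ONE HOROCYCLE STEP from the representative
  hypothesis — ★ R1's (H2-tr) with `htrace` replaced by `hrep` (= ★ V2a's conclusion as a binder); conclusion VERBATIM.
* §2 **(H2-ram)** `…_of_adj_zero_of_ramified` (`hσ hvσ hϖ heven hd h1d h2t`) and **(H2-datum)** `…_of_adj_zero_of_isRamifiedQuadraticDatum` (`hD : IsRamifiedQuadraticDatum σ ϖ d t`,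
  U0 currency): conclusion VERBATIM = ★ (H2)'s — the `hH4` binder of ★ (S)∕(H5)–(H8)∕orbit-data `_of_involution` heads at `j` even, root case.

## References
* [BruhatTits1972] F. Bruhat, J. Tits, *Groupes réductifs sur un corps local I*, Publ. Math. IHÉS 41 (1972), §10 (lattice models of the rank-one unitary building), (4.4.4)
  (the stabiliser of a vertex is transitive on the chambers containing it), (7.4.18).
* [Tits1979] J. Tits, *Reductive groups over local fields*, Proc. Sympos. Pure Math. 33.1 (1979), §2.7 (p. 48), §2.10 (p. 49) (rank one: the building is a tree; the ramified `SU₃`,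
  all residue characteristics), §3.3.3.
* [Serre1980Trees] J.-P. Serre, *Trees* (1980), Ch. II §1.1 (lattices, the apartment of diagonal lattices, the action of unipotent matrices), Ch. I §2.
* [Rogawski1990] J. D. Rogawski, *Automorphic Representations of Unitary Groups in Three Variables*, Ann. of Math. Stud. 123 (1990), §1.10 p. 9 (`B = MN`, `N = {u(x, z)}`), §4.5 p. 45.
* [Jacobowitz1962] R. Jacobowitz, *Hermitian forms over local fields*, Amer. J. Math. 84 (1962), §§9–11 (ramified dyadic hermitian lattices).
-/

set_option autoImplicit false

noncomputable section

open scoped Valued WithZero Matrix MatrixGroups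

namespace Literature.NumberTheory.Automorphic.UnitaryLatticeTree

open _root_.SimpleGraph Literature.NumberTheory.Automorphic Literature.NumberTheory.Automorphic.HermitianLattice
open Literature.NumberTheory.Automorphic.CartanUnique (uniformizer_ne_zero uniformizer_mem_integer)
open Literature.NumberTheory.Automorphic.UnitaryGroup
open Literature.NumberTheory.Automorphic.UnitaryThreeFourFrame

variable {K : Type*} [Field K] [Valued K ℤᵐ⁰] {σ : K →+* K} {ϖ : K}

/-! ## §1 The root star as one horocycle step from an isotropic representative: `star(A 0) = {A (−1)} ⊔ (N ∩ Stab(A 0)) · A 1` -/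

/-- **(H2) FROM AN ISOTROPIC REPRESENTATIVE OF EACH NEIGHBOUR — THE ROOT STAR AS ONE HOROCYCLE STEP**: a neighbour `y` of the root `A 0 = 𝒪³` other than `A (−1) = N₁` is `n · A 1`
for a unipotent upper-triangular `n ∈ N` fixing `A 0`.  This is ★ R1's (H2-tr) `exists_mem_unipotentU_apply_apartmentEnum_one_eq_of_adj_zero_of_trace` with its trace hypothesis
`htrace` replaced by ★ V2a's CONCLUSION as the binder `hrep` (every vertex of the star of the root is `N_x`, `x ∈ 𝒪³` primitive, exactly isotropic) — the only place (H2-tr) reads the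
trace element; the proof below is ★ R1's token for token from its first `obtain` on: if `|x₂| < 1` isotropy forces `|x₁| < 1`, `|x₀| = 1` and `N_x = N₁ = A (−1)` (excluded); if `|x₂| = 1`
the Heisenberg element with last column `x ∕ x₂` (unitary because `x` is isotropic, ★ `mem_unitaryGroupOfForm_iff_of_coe_eq_upperUnipotent`) fixes `𝒪³` and carries
`A 1 = N_{e₂} = latt diag(ϖ,1,1)` onto `N_x`.  Conclusion VERBATIM = ★ (H2)'s. [cite: BruhatTits1972, (4.4.4) and §10] [cite: Serre1980Trees, II.1.1] [cite: Rogawski1990, §1.10 p. 9] -/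
theorem exists_mem_unipotentU_apply_apartmentEnum_one_eq_of_adj_zero_of_isotropicRep (hσ : ∀ x, σ (σ x) = x) (hvσ : ∀ a, Valued.v (σ a) = Valued.v a) (hϖ : Valued.v ϖ = WithZero.exp (-1 : ℤ))
    (hrep : ∀ {w : {M : Submodule 𝒪[K] (Fin 3 → K) // IsVertex σ ϖ ((StdForm.antidiagonal 3).over K) M}},
      w ∈ (latticeGraph σ ϖ ((StdForm.antidiagonal 3).over K)).neighborSet ⟨stdLattice K 3, 0, isSelfDualLattice_stdLattice_three_of_v hϖ⟩ →
      ∃ x : Fin 3 → K, x ∈ stdLattice K 3 ∧ (∃ j, Valued.v (x j) = 1) ∧ B₀ σ 3 x x = 0 ∧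
        ∀ y, y ∈ w.1 ↔ y ∈ stdLattice K 3 ∧ Valued.v (B₀ σ 3 x y) < 1)
    (A : ℤ → {M : Submodule 𝒪[K] (Fin 3 → K) // IsVertex σ ϖ ((StdForm.antidiagonal 3).over K) M})
    (hA0 : ∀ a : ℤ, (A (2 * a)).1 = latt (Matrix.diagonal ![ϖ ^ a, (1 : K), ϖ ^ (-a)]))
    (hA1 : ∀ a : ℤ, (A (2 * a + 1)).1 = latt (Matrix.diagonal ![ϖ ^ (a + 1), (1 : K), ϖ ^ (-a)]))
    {y : {M : Submodule 𝒪[K] (Fin 3 → K) // IsVertex σ ϖ ((StdForm.antidiagonal 3).over K) M}}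
    (hy : (latticeGraph σ ϖ ((StdForm.antidiagonal 3).over K)).Adj (A 0) y) (hy' : y ≠ A (-1)) :
    ∃ n : unitaryGroupOfForm σ ((StdForm.antidiagonal 3).over K), n ∈ unipotentU σ ((StdForm.antidiagonal 3).over K) ∧
      latticeGraphIso σ ϖ ((StdForm.antidiagonal 3).over K) n (A 0) = A 0 ∧ latticeGraphIso σ ϖ ((StdForm.antidiagonal 3).over K) n (A 1) = y := by
  have hϖ0 : ϖ ≠ 0 := uniformizer_ne_zero hϖ
  have hϖ1 : Valued.v ϖ ≤ 1 := v_le_one_of_v_eq_exp_neg_one hϖ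
  have hlt1 : ∀ z : K, Valued.v z < 1 ↔ Valued.v z ≤ Valued.v ϖ := fun z => by rw [hϖ]; exact v_lt_one_iff z
  have hA0' : (A 0).1 = stdLattice K 3 := coe_apartmentEnum_zero A hA0
  have hAm1 : (A (-1)).1 = latt (Matrix.diagonal ![(1 : K), 1, ϖ]) := by
    have h := hA1 (-1)
    rw [show (2 : ℤ) * (-1) + 1 = -1 by norm_num, show (-1 : ℤ) + 1 = 0 by norm_num, neg_neg, zpow_zero, zpow_one] at h
    exact h
  have hA1' : (A 1).1 = latt (Matrix.diagonal ![ϖ, (1 : K), 1]) := by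
    have h := hA1 0
    rw [show (2 : ℤ) * 0 + 1 = 1 by norm_num, zero_add, neg_zero, zpow_zero, zpow_one] at h
    exact h
  -- the representative: `y = N_x` (binder `hrep`; ★ V2a at an unramified ∕ tame place, ★ `…_of_even` at a ramified datum)
  have hroot : A 0 = ⟨stdLattice K 3, 0, isSelfDualLattice_stdLattice_three_of_v hϖ⟩ := Subtype.ext hA0'
  have hw : y ∈ (latticeGraph σ ϖ ((StdForm.antidiagonal 3).over K)).neighborSet ⟨stdLattice K 3, 0, isSelfDualLattice_stdLattice_three_of_v hϖ⟩ := by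
    rw [SimpleGraph.mem_neighborSet, ← hroot]; exact hy
  obtain ⟨x, hxint, ⟨j, hxj⟩, hxiso, hmem⟩ := hrep hw
  have hxiso' : σ (x 0) * x 2 + σ (x 1) * x 1 + σ (x 2) * x 0 = 0 := by rw [← B₀_three_apply]; exact hxiso
  have hx : ∀ i, Valued.v (x i) ≤ 1 := hxint
  by_cases h2 : Valued.v (x 2) < 1
  · -- `|x₂| < 1`: then `y = A (−1)`, excluded
    exfalso; apply hy'
    have hx1 : Valued.v (x 1) < 1 := by
      have h : σ (x 1) * x 1 = -(σ (x 0) * x 2 + σ (x 2) * x 0) := by linear_combination hxiso'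
      have hv : Valued.v (σ (x 1) * x 1) < 1 := by
        rw [h, Valuation.map_neg]
        refine (Valuation.map_add _ _ _).trans_lt (max_lt ?_ ?_)
        · rw [map_mul, hvσ]
          calc Valued.v (x 0) * Valued.v (x 2) ≤ 1 * Valued.v (x 2) := mul_le_mul_left (hx 0) _
            _ < 1 := by rw [one_mul]; exact h2
        · rw [map_mul, hvσ]
          calc Valued.v (x 2) * Valued.v (x 0) ≤ Valued.v (x 2) * 1 := mul_le_mul_right (hx 0) _
            _ < 1 := by rw [mul_one]; exact h2
      rw [map_mul, hvσ] at hv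
      by_contra hge
      have h1 : Valued.v (x 1) = 1 := le_antisymm (hx 1) (not_lt.1 hge)
      rw [h1, mul_one] at hv
      exact lt_irrefl _ hv
    have hx0 : Valued.v (x 0) = 1 := by
      fin_cases j
      · exact hxj
      · exact absurd hxj hx1.ne
      · exact absurd hxj h2.ne
    apply Subtype.ext
    rw [hAm1]
    ext y'
    have hdiag : ∀ i, (![(1 : K), 1, ϖ] : Fin 3 → K) i ≠ 0 := by intro i; fin_cases i <;> simp [hϖ0]
    rw [hmem, mem_latt_diagonal_iff hdiag, Fin.forall_fin_succ, Fin.forall_fin_two, B₀_three_apply]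
    simp only [Fin.succ_zero_eq_one, Fin.succ_one_eq_two, Matrix.cons_val_zero, Matrix.cons_val_one, Matrix.cons_val_two, Matrix.tail_cons, Matrix.head_cons, map_one]
    constructor
    · rintro ⟨hy'int, hB⟩
      have hi : ∀ i, Valued.v (y' i) ≤ 1 := hy'int
      refine ⟨hi 0, hi 1, (hlt1 _).1 ?_⟩
      -- `|y₂| < 1`: `σx₀ y₂ = B₀ − σx₁ y₁ − σx₂ y₀` with `|σx₀| = 1`
      have h : σ (x 0) * y' 2 = (σ (x 0) * y' 2 + σ (x 1) * y' 1 + σ (x 2) * y' 0) - σ (x 1) * y' 1 - σ (x 2) * y' 0 := by ring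
      have hv : Valued.v (σ (x 0) * y' 2) < 1 := by
        rw [h]
        refine (Valuation.map_sub _ _ _).trans_lt (max_lt ((Valuation.map_sub _ _ _).trans_lt (max_lt hB ?_)) ?_)
        · rw [map_mul, hvσ]
          calc Valued.v (x 1) * Valued.v (y' 1) ≤ Valued.v (x 1) * 1 := mul_le_mul_right (hi 1) _
            _ < 1 := by rw [mul_one]; exact hx1
        · rw [map_mul, hvσ]
          calc Valued.v (x 2) * Valued.v (y' 0) ≤ Valued.v (x 2) * 1 := mul_le_mul_right (hi 0) _
            _ < 1 := by rw [mul_one]; exact h2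
      rwa [map_mul, hvσ, hx0, one_mul] at hv
    · rintro ⟨h0, h1, h2'⟩
      have hi : ∀ i, Valued.v (y' i) ≤ 1 := by
        intro i; fin_cases i
        · exact h0
        · exact h1
        · exact h2'.trans hϖ1
      refine ⟨hi, ?_⟩
      refine (Valuation.map_add _ _ _).trans_lt (max_lt ((Valuation.map_add _ _ _).trans_lt (max_lt ?_ ?_)) ?_)
      · rw [map_mul, hvσ, hx0, one_mul]; exact (hlt1 _).2 h2'
      · rw [map_mul, hvσ]
        calc Valued.v (x 1) * Valued.v (y' 1) ≤ Valued.v (x 1) * 1 := mul_le_mul_right (hi 1) _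
          _ < 1 := by rw [mul_one]; exact hx1
      · rw [map_mul, hvσ]
        calc Valued.v (x 2) * Valued.v (y' 0) ≤ Valued.v (x 2) * 1 := mul_le_mul_right (hi 0) _
          _ < 1 := by rw [mul_one]; exact h2
  · -- `|x₂| = 1`: the Heisenberg element with last column `x ∕ x₂`
    have hx2 : Valued.v (x 2) = 1 := le_antisymm (hx 2) (not_lt.1 h2)
    have hx2' : x 2 ≠ 0 := fun h => by rw [h, map_zero] at hx2; exact zero_ne_one hx2
    have hσx2 : σ (x 2) ≠ 0 := (map_ne_zero σ).2 hx2'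
    have hvσx2 : Valued.v (σ (x 2)) = 1 := by rw [hvσ, hx2]
    set a : K := -σ (x 1 / x 2) with ha
    set b : K := x 0 / x 2 with hb
    set c : K := x 1 / x 2 with hc
    have hva : Valued.v a ≤ 1 := by rw [ha, Valuation.map_neg, hvσ, map_div₀, hx2, div_one]; exact hx 1
    have hvb : Valued.v b ≤ 1 := by rw [hb, map_div₀, hx2, div_one]; exact hx 0
    have hvc : Valued.v c ≤ 1 := by rw [hc, map_div₀, hx2, div_one]; exact hx 1
    have hσa : σ a = -c := by rw [ha, map_neg, hσ]
    have hcσ : c = -σ a := by rw [hσa, neg_neg]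
    have hrel : b + σ b + a * σ a = 0 := by
      rw [hσa, ha, hb, hc, map_div₀, map_div₀]
      field_simp
      linear_combination hxiso'
    have hacb : a * c - b = σ b := by linear_combination (-1 : K) * hrel + a * hcσ
    have hvacb : Valued.v (a * c - b) ≤ 1 := by rw [hacb, hvσ]; exact hvb
    -- the element
    let nM : Matrix (Fin 3) (Fin 3) K := !![1, a, b; 0, 1, c; 0, 0, 1]
    let nMi : Matrix (Fin 3) (Fin 3) K := !![1, -a, a * c - b; 0, 1, -c; 0, 0, 1]
    have hmul : nM * nMi = 1 := by
      ext i j; fin_cases i <;> fin_cases j <;> simp [nM, nMi, Matrix.mul_apply, Fin.sum_univ_three]; ring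
    have hmul' : nMi * nM = 1 := by
      ext i j; fin_cases i <;> fin_cases j <;> simp [nM, nMi, Matrix.mul_apply, Fin.sum_univ_three]; ring
    let nG : GL (Fin 3) K := ⟨nM, nMi, hmul, hmul'⟩
    have hnU : nG ∈ unitaryGroupOfForm σ ((StdForm.antidiagonal 3).over K) :=
      (mem_unitaryGroupOfForm_iff_of_coe_eq_upperUnipotent σ hσ (u := nG) rfl).2 ⟨hcσ, hrel⟩
    refine ⟨⟨nG, hnU⟩, ?_, ?_, ?_⟩
    · rw [mem_unipotentU_iff]
      refine ⟨?_, fun i => ?_⟩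
      · intro i j hij
        change (j : Fin 3) < i at hij
        change nM i j = 0
        fin_cases i <;> fin_cases j <;> simp [nM] at hij ⊢
      · change nM i i = 1
        fin_cases i <;> simp [nM]
    · -- `n` fixes the root
      apply Subtype.ext
      change mapGL nG (A 0).1 = (A 0).1
      rw [hA0', mapGL_stdLattice_eq_iff]
      refine ⟨fun i j => ?_, fun i j => ?_⟩
      · change Valued.v (nM i j) ≤ 1
        fin_cases i <;> fin_cases j <;> simp [nM, hva, hvb, hvc]
      · change Valued.v (nMi i j) ≤ 1
        fin_cases i <;> fin_cases j <;> simp [nMi, Valuation.map_neg, hva, hvc, hvacb]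
    · -- `n · A 1 = y`
      apply Subtype.ext
      change mapGL nG (A 1).1 = y.1
      rw [hA1']
      ext y'
      have hdiag : ∀ i, (![ϖ, (1 : K), 1] : Fin 3 → K) i ≠ 0 := by intro i; fin_cases i <;> simp [hϖ0]
      obtain ⟨e0, e1, e2⟩ := upperUnipotent_mulVec (-a) (a * c - b) (-c) y'
      have key : nMi.mulVec y' 0 = (σ (x 2))⁻¹ * B₀ σ 3 x y' := by
        change (!![1, -a, a * c - b; 0, 1, -c; 0, 0, 1] : Matrix (Fin 3) (Fin 3) K).mulVec y' 0 = _
        rw [e0, B₀_three_apply, hacb, ha, hb, hc, map_div₀, map_div₀]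
        field_simp
        ring
      have e1' : nMi.mulVec y' 1 = y' 1 - c * y' 2 := by
        change (!![1, -a, a * c - b; 0, 1, -c; 0, 0, 1] : Matrix (Fin 3) (Fin 3) K).mulVec y' 1 = _
        rw [e1]; ring
      have e2' : nMi.mulVec y' 2 = y' 2 := e2
      rw [mem_mapGL_iff, hmem y', B₀_three_apply]
      change nMi.mulVec y' ∈ latt (Matrix.diagonal ![ϖ, (1 : K), 1]) ↔ _
      rw [mem_latt_diagonal_iff hdiag, Fin.forall_fin_succ, Fin.forall_fin_two]
      simp only [Fin.succ_zero_eq_one, Fin.succ_one_eq_two, Matrix.cons_val_zero, Matrix.cons_val_one, Matrix.cons_val_two, Matrix.tail_cons, Matrix.head_cons, map_one]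
      rw [key, e1', e2', B₀_three_apply, map_mul, map_inv₀, hvσx2, inv_one, one_mul]
      constructor
      · rintro ⟨h0, h1, h2'⟩
        have hy1 : Valued.v (y' 1) ≤ 1 := by
          have e : y' 1 = (y' 1 - c * y' 2) + c * y' 2 := by ring
          rw [e]; exact v_add_le_one_of_le h1 (v_mul_le_one_of_le hvc h2')
        have hy0 : Valued.v (y' 0) ≤ 1 := by
          have e : y' 0 = (σ (x 2))⁻¹ * (σ (x 0) * y' 2 + σ (x 1) * y' 1 + σ (x 2) * y' 0) - -a * y' 1 - (a * c - b) * y' 2 := by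
            rw [hacb, ha, hb, hc, map_div₀, map_div₀]; field_simp; ring
          rw [e]
          refine v_sub_le_one_of_le (v_sub_le_one_of_le ?_ (v_mul_le_one_of_le (by rw [Valuation.map_neg]; exact hva) hy1)) (v_mul_le_one_of_le hvacb h2')
          rw [map_mul, map_inv₀, hvσx2, inv_one, one_mul]; exact h0.trans hϖ1
        refine ⟨?_, (hlt1 _).2 h0⟩
        intro i; fin_cases i
        · exact hy0
        · exact hy1
        · exact h2'
      · rintro ⟨hi, hB⟩
        have hi' : ∀ i, Valued.v (y' i) ≤ 1 := hi
        exact ⟨(hlt1 _).1 hB, v_sub_le_one_of_le (hi' 1) (v_mul_le_one_of_le hvc (hi' 2)), hi' 2⟩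

/-! ## §2 The root-star step at a ramified quadratic datum (tame or wild) -/

/-- **(H2) AT A RAMIFIED QUADRATIC DATUM (tame or WILD) — THE ROOT STAR AS ONE HOROCYCLE STEP, unconditionally**: letters `(hσ hvσ hϖ heven hd h1d h2t)` (no `σϖ = −ϖ`, no
`|2| = 1`); `hrep` := ★ p854714 `exists_isotropic_forall_mem_iff_of_mem_neighborSet_root_of_even`.  Conclusion VERBATIM = ★ (H2)'s ∕ ★ (H2-v2)'s — at `|2| = 1` it re-proves ★ R1's `…_of_v_two`, at `|2| < 1` it is new.
[cite: BruhatTits1972, (4.4.4) and §10] [cite: Tits1979, §2.7 (p. 48), §2.10 (p. 49)] [cite: Serre1980Trees, II.1.1] -/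
theorem exists_mem_unipotentU_apply_apartmentEnum_one_eq_of_adj_zero_of_ramified [Finite 𝓀[K]] (hσ : ∀ x, σ (σ x) = x) (hvσ : ∀ a, Valued.v (σ a) = Valued.v a)
    (hϖ : Valued.v ϖ = WithZero.exp (-1 : ℤ)) (heven : ∀ x : K, σ x = x → x ≠ 0 → ∃ n : ℤ, Valued.v x = WithZero.exp (2 * n)) {d t : ℕ}
    (hd : Valued.v (ϖ - σ ϖ) = Valued.v ϖ ^ d) (h1d : 1 ≤ d) (h2t : Valued.v (2 : K) = Valued.v ϖ ^ t)
    (A : ℤ → {M : Submodule 𝒪[K] (Fin 3 → K) // IsVertex σ ϖ ((StdForm.antidiagonal 3).over K) M})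
    (hA0 : ∀ a : ℤ, (A (2 * a)).1 = latt (Matrix.diagonal ![ϖ ^ a, (1 : K), ϖ ^ (-a)]))
    (hA1 : ∀ a : ℤ, (A (2 * a + 1)).1 = latt (Matrix.diagonal ![ϖ ^ (a + 1), (1 : K), ϖ ^ (-a)]))
    {y : {M : Submodule 𝒪[K] (Fin 3 → K) // IsVertex σ ϖ ((StdForm.antidiagonal 3).over K) M}}
    (hy : (latticeGraph σ ϖ ((StdForm.antidiagonal 3).over K)).Adj (A 0) y) (hy' : y ≠ A (-1)) :
    ∃ n : unitaryGroupOfForm σ ((StdForm.antidiagonal 3).over K), n ∈ unipotentU σ ((StdForm.antidiagonal 3).over K) ∧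
      latticeGraphIso σ ϖ ((StdForm.antidiagonal 3).over K) n (A 0) = A 0 ∧ latticeGraphIso σ ϖ ((StdForm.antidiagonal 3).over K) n (A 1) = y :=
  exists_mem_unipotentU_apply_apartmentEnum_one_eq_of_adj_zero_of_isotropicRep hσ hvσ hϖ
    (fun hw => exists_isotropic_forall_mem_iff_of_mem_neighborSet_root_of_even hσ hvσ hϖ heven hd h1d h2t hw) A hA0 hA1 hy hy'

end Literature.NumberTheory.Automorphic.UnitaryLatticeTree

/-! ### The datum token's shape (`IsRamifiedQuadraticDatum` lives at `K : Type`) -/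

namespace Literature.NumberTheory.Automorphic.UnitaryLatticeTree

open _root_.SimpleGraph Literature.NumberTheory.Automorphic Literature.NumberTheory.Automorphic.HermitianLattice
open Literature.NumberTheory.Automorphic.UnitaryGroup
open Literature.NumberTheory.Automorphic.UnitaryThreeFourFrame

variable {K : Type} [Field K] [Valued K ℤᵐ⁰] {σ : K →+* K} {ϖ : K}

/-- **(H2) IN THE DATUM TOKEN'S SHAPE** (`hD : IsRamifiedQuadraticDatum σ ϖ d t`, the currency of Track A's unit U0 `F0_P3c_DyRamFourFrame_U0_WildTree`): the root-star horocycle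
step at every ramified quadratic datum with finite residue field — the even-`j`, root case of the `hH4` binder of ★ (S) `eq_apartmentEnum_sub_one_or_exists_mem_unipotentU_of_adj_of_involution`,
★ (H5)–(H8) `…HorosphereTransversalOfInvolution` and ★ `exists_vertexOrbitData_of_involution` ∕ `exists_edgeOrbitData_of_involution`.  Conclusion VERBATIM = ★ (H2)'s.
[cite: BruhatTits1972, (4.4.4) and §10] [cite: Tits1979, §2.7 (p. 48)] [cite: Serre1980Trees, II.1.1] -/
theorem exists_mem_unipotentU_apply_apartmentEnum_one_eq_of_adj_zero_of_isRamifiedQuadraticDatum [Finite 𝓀[K]] {d t : ℕ} (hD : IsRamifiedQuadraticDatum σ ϖ d t)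
    (A : ℤ → {M : Submodule 𝒪[K] (Fin 3 → K) // IsVertex σ ϖ ((StdForm.antidiagonal 3).over K) M})
    (hA0 : ∀ a : ℤ, (A (2 * a)).1 = latt (Matrix.diagonal ![ϖ ^ a, (1 : K), ϖ ^ (-a)]))
    (hA1 : ∀ a : ℤ, (A (2 * a + 1)).1 = latt (Matrix.diagonal ![ϖ ^ (a + 1), (1 : K), ϖ ^ (-a)]))
    {y : {M : Submodule 𝒪[K] (Fin 3 → K) // IsVertex σ ϖ ((StdForm.antidiagonal 3).over K) M}}
    (hy : (latticeGraph σ ϖ ((StdForm.antidiagonal 3).over K)).Adj (A 0) y) (hy' : y ≠ A (-1)) :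
    ∃ n : unitaryGroupOfForm σ ((StdForm.antidiagonal 3).over K), n ∈ unipotentU σ ((StdForm.antidiagonal 3).over K) ∧
      latticeGraphIso σ ϖ ((StdForm.antidiagonal 3).over K) n (A 0) = A 0 ∧ latticeGraphIso σ ϖ ((StdForm.antidiagonal 3).over K) n (A 1) = y :=
  exists_mem_unipotentU_apply_apartmentEnum_one_eq_of_adj_zero_of_ramified hD.1 hD.2.1 hD.2.2.1 hD.2.2.2.1 hD.2.2.2.2.1 hD.2.2.2.2.2.1 hD.2.2.2.2.2.2 A hA0 hA1 hy hy'

end Literature.NumberTheory.Automorphic.UnitaryLatticeTree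

end
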